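import Mathlib.MeasureTheory.Function.Jacobian
import Mathlib.Analysis.Calculus.InverseFunctionTheorem.FDeriv
import Mathlib.Data.Real.ENatENNReal
import HarnessLib

/-!
# The area formula with multiplicity for locally injective differentiable maps

For a finite-dimensional real normed space `E` with an additive Haar measure `μ`, a measurable
set `s ⊆ E` and a map `f : E → E` differentiable on `s` (relative to `s`) with derivative `f'`,
which is **locally injective on `s`** (every point of `s` has a neighbourhood within `s` on
which `f` is injective), we prove the *area formula counting multiplicity*

`∫⁻ x in s, |det f'(x)| · g (f x) ∂μ = ∫⁻ y, #(f ⁻¹' {y} ∩ s) · g y ∂μ`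

(`lintegral_abs_det_fderiv_mul_eq_lintegral_encard_mul`; `g = 1`:
`lintegral_abs_det_fderiv_eq_lintegral_encard`), where the multiplicity
`#(f ⁻¹' {y} ∩ s) ∈ ℕ∞` is `Set.encard`, coerced into `ℝ≥0∞`, together with the measurability of
the multiplicity function (`measurable_encard_preimage_inter`). This is the area formula of
geometric measure theory (Federer, *Geometric Measure Theory*, 3.2.3 and 3.2.5; Evans–Gariepy,
*Measure Theory and Fine Properties of Functions*, Thm. 3.8 and Thm. 3.9, PDF pp. 76–78:
`∫_A Jf dx = ∫ 𝓗⁰(A ∩ f⁻¹{y}) d𝓗ⁿ(y)` for Lipschitz `f : ℝⁿ → ℝⁿ`) in the special case of a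
locally injective map, where — as in Evans–Gariepy's proof, Step 8, Case `Jf > 0` — it reduces
to countable additivity and the *injective* change-of-variables formula, which Mathlib has as
`MeasureTheory.lintegral_image_eq_lintegral_abs_det_fderiv_mul` (differentiability relative to
the set replaces the Lipschitz hypothesis, exactly as in Mathlib's injective version). The
immersion case (strict derivative with non-zero determinant at every point of an open set, hence
local injectivity by the inverse function theorem) is `lintegral_abs_det_fderiv_eq_lintegral_encard_of_det_ne_zero`.

## The argument

Choose for every `x ∈ s` an open `V ∋ x` with `f` injective on `V ∩ s`; countably many of them
cover `s` (second countability, `TopologicalSpace.countable_cover_nhdsWithin`); disjointify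
(`disjointed`) to get measurable, pairwise disjoint `A n ⊆ s` covering `s` with `f` injective
on each (`exists_disjoint_cover_injOn`). Then the left-hand side is
`∑ₙ ∫⁻_{A n} |det f'| g∘f = ∑ₙ ∫⁻_{f '' A n} g` by Mathlib's injective formula, while for every
`y` the number of points of `s` over `y` is the number of `n` with `y ∈ f '' A n`
(`encard_preimage_inter_eq_tsum_indicator`), so the right-hand side is the same sum by monotone
convergence (`lintegral_tsum`).

No new definitions are made.

## References

* H. Federer, *Geometric Measure Theory*, Springer 1969: Thm. 3.2.3, Cor. 3.2.5.
* L. C. Evans, R. F. Gariepy, *Measure Theory and Fine Properties of Functions*, revised ed.,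
  CRC Press 2015: Thm. 3.8 (area formula), Thm. 3.9 (change of variables), PDF pp. 76–78.
-/

noncomputable section

open MeasureTheory MeasureTheory.Measure Set Filter Function TopologicalSpace
open scoped ENNReal Topology NNReal

namespace Literature.Analysis.Calculus

/-! ### Counting the points of a fibre through a disjoint decomposition -/

section Count

variable {α β : Type*}

/-- If `s` is covered by pairwise disjoint subsets `A n ⊆ s` (`n ∈ ℕ`) on each of which `f` is
injective, then for every `y` the number of points of `s` mapping to `y` (an extended natural
number) equals the number of indices `n` with `y ∈ f '' A n`, written as a sum of indicators.
[folklore] -/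
theorem encard_preimage_inter_eq_tsum_indicator {f : α → β} {s : Set α} {A : ℕ → Set α}
    (hAs : ∀ n, A n ⊆ s) (hsA : s ⊆ ⋃ n, A n) (hdisj : Pairwise (Disjoint on A))
    (hinj : ∀ n, InjOn f (A n)) (y : β) :
    ((f ⁻¹' {y} ∩ s).encard : ℝ≥0∞) = ∑' n, (f '' A n).indicator 1 y := by
  classical
  set T : Set ℕ := {n | y ∈ f '' A n} with hT
  have hex : ∀ n : T, ∃ x ∈ A n, f x = y := fun n ↦ (mem_image _ _ _).mp n.2
  choose x hxA hxy using hex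
  have hmem : ∀ n : T, x n ∈ f ⁻¹' {y} ∩ s := fun n ↦ ⟨hxy n, hAs n (hxA n)⟩
  have hbij : Bijective (fun n : T ↦ (⟨x n, hmem n⟩ : ↥(f ⁻¹' {y} ∩ s))) := by
    constructor
    · intro n m h
      have h' : x n = x m := congrArg Subtype.val h
      by_contra hnm
      exact (hdisj (Subtype.val_injective.ne hnm)).ne_of_mem (hxA n) (hxA m) h'
    · rintro ⟨z, hzy, hzs⟩
      obtain ⟨n, hn⟩ := mem_iUnion.mp (hsA hzs)
      have hnT : n ∈ T := ⟨z, hn, hzy⟩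
      exact ⟨⟨n, hnT⟩, Subtype.ext (hinj n (hxA ⟨n, hnT⟩) hn ((hxy ⟨n, hnT⟩).trans hzy.symm))⟩
  rw [← encard_congr (Equiv.ofBijective _ hbij), ← ENNReal.tsum_set_one T]
  have h1 : ∑' _ : T, (1 : ℝ≥0∞) = ∑' n, T.indicator 1 n := tsum_subtype T 1
  rw [h1]
  refine tsum_congr fun n ↦ ?_
  by_cases hn : n ∈ T
  · rw [indicator_of_mem hn, indicator_of_mem (show y ∈ f '' A n from hn)]
    rfl
  · rw [indicator_of_notMem hn, indicator_of_notMem (show y ∉ f '' A n from hn)]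

end Count

/-! ### A disjoint measurable decomposition on whose pieces `f` is injective -/

section Cover

variable {E : Type*} [TopologicalSpace E] [SecondCountableTopology E] [MeasurableSpace E]
  [OpensMeasurableSpace E] {β : Type*} {f : E → β} {s : Set E}

/-- A map which is locally injective on a measurable set `s` of a second countable space (every
`x ∈ s` has a neighbourhood within `s` on which `f` is injective) is injective on each piece of
a countable decomposition of `s` into pairwise disjoint measurable subsets (Lindelöf property and
disjointification). [folklore] -/
theorem exists_disjoint_cover_injOn (hs : MeasurableSet s) (hne : s.Nonempty)
    (hinj : ∀ x ∈ s, ∃ U ∈ 𝓝[s] x, InjOn f U) :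
    ∃ A : ℕ → Set E, (∀ n, MeasurableSet (A n)) ∧ (∀ n, A n ⊆ s) ∧ s ⊆ ⋃ n, A n ∧
      Pairwise (Disjoint on A) ∧ ∀ n, InjOn f (A n) := by
  have hV : ∀ x ∈ s, ∃ V : Set E, IsOpen V ∧ x ∈ V ∧ InjOn f (V ∩ s) := by
    intro x hx
    obtain ⟨U, hU, hU'⟩ := hinj x hx
    obtain ⟨V, hVo, hxV, hVU⟩ := mem_nhdsWithin.mp hU
    exact ⟨V, hVo, hxV, hU'.mono hVU⟩
  choose! V hVo hxV hVinj using hV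
  obtain ⟨t, hts, htc, hst⟩ := countable_cover_nhdsWithin (f := fun x ↦ V x ∩ s) (s := s)
    (fun x hx ↦ mem_nhdsWithin.mpr ⟨V x, hVo x hx, hxV x hx, Subset.rfl⟩)
  have htne : t.Nonempty := by
    obtain ⟨x, hx⟩ := hne
    obtain ⟨y, hy, -⟩ := mem_iUnion₂.mp (hst hx)
    exact ⟨y, hy⟩
  obtain ⟨u, rfl⟩ := htc.exists_eq_range htne
  set B : ℕ → Set E := fun n ↦ V (u n) ∩ s with hB
  refine ⟨disjointed B, ?_, ?_, ?_, disjoint_disjointed B, ?_⟩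
  · exact MeasurableSet.disjointed fun n ↦ (hVo _ (hts ⟨n, rfl⟩)).measurableSet.inter hs
  · exact fun n ↦ (disjointed_subset B n).trans inter_subset_right
  · rw [iUnion_disjointed]
    intro x hx
    obtain ⟨y, ⟨n, rfl⟩, hy⟩ := mem_iUnion₂.mp (hst hx)
    exact mem_iUnion.mpr ⟨n, hy⟩
  · exact fun n ↦ (hVinj _ (hts ⟨n, rfl⟩)).mono (disjointed_subset B n)

end Cover

/-! ### The area formula with multiplicity -/

section Area

variable {E : Type*} [NormedAddCommGroup E] [NormedSpace ℝ E] [FiniteDimensional ℝ E]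
  [MeasurableSpace E] [BorelSpace E] (μ : Measure E) [IsAddHaarMeasure μ]
  {s : Set E} {f : E → E} {f' : E → E →L[ℝ] E}

/-- **Area formula with multiplicity, weighted form** (Federer 3.2.3/3.2.5; Evans–Gariepy
Thm. 3.9 "`∫ g(x) Jf(x) dx = ∫ [∑_{x ∈ f⁻¹{y}} g(x)] dy`", here with a weight `g ∘ f` depending
on the value only, so that the inner sum is `#(f⁻¹{y} ∩ s) · g(y)`), for a map `f` that is
differentiable on the measurable set `s` relative to `s` and locally injective on `s`:
`∫⁻_{s} |det f'| · (g ∘ f) dμ = ∫⁻ #(f ⁻¹' {y} ∩ s) · g y dμ(y)`.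
[cite: EvansGariepy2015, Thm. 3.9 (PDF p. 78)] -/
theorem lintegral_abs_det_fderiv_mul_eq_lintegral_encard_mul (hs : MeasurableSet s)
    (hf' : ∀ x ∈ s, HasFDerivWithinAt f (f' x) s x)
    (hinj : ∀ x ∈ s, ∃ U ∈ 𝓝[s] x, InjOn f U) {g : E → ℝ≥0∞} (hg : Measurable g) :
    ∫⁻ x in s, ENNReal.ofReal |(f' x).det| * g (f x) ∂μ =
      ∫⁻ y, ((f ⁻¹' {y} ∩ s).encard : ℝ≥0∞) * g y ∂μ := by
  rcases s.eq_empty_or_nonempty with rfl | hne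
  · simp
  obtain ⟨A, hAm, hAs, hsA, hdisj, hAinj⟩ := exists_disjoint_cover_injOn hs hne hinj
  have hsU : s = ⋃ n, A n := Subset.antisymm hsA (iUnion_subset hAs)
  have hderiv : ∀ n, ∀ x ∈ A n, HasFDerivWithinAt f (f' x) (A n) x :=
    fun n x hx ↦ (hf' x (hAs n hx)).mono (hAs n)
  have himg : ∀ n, MeasurableSet (f '' A n) :=
    fun n ↦ measurable_image_of_fderivWithin (hAm n) (hderiv n) (hAinj n)
  calc ∫⁻ x in s, ENNReal.ofReal |(f' x).det| * g (f x) ∂μ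
      = ∑' n, ∫⁻ x in A n, ENNReal.ofReal |(f' x).det| * g (f x) ∂μ := by
        rw [hsU]
        exact lintegral_iUnion hAm hdisj _
    _ = ∑' n, ∫⁻ y in f '' A n, g y ∂μ := by
        refine tsum_congr fun n ↦ ?_
        exact (lintegral_image_eq_lintegral_abs_det_fderiv_mul μ (hAm n) (hderiv n) (hAinj n) g).symm
    _ = ∑' n, ∫⁻ y, (f '' A n).indicator 1 y * g y ∂μ := by
        refine tsum_congr fun n ↦ ?_
        rw [← lintegral_indicator (himg n)]
        refine lintegral_congr fun y ↦ ?_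
        by_cases hy : y ∈ f '' A n <;> simp [hy]
    _ = ∫⁻ y, ∑' n, (f '' A n).indicator 1 y * g y ∂μ := by
        rw [lintegral_tsum]
        exact fun n ↦ ((measurable_one.indicator (himg n)).mul hg).aemeasurable
    _ = ∫⁻ y, ((f ⁻¹' {y} ∩ s).encard : ℝ≥0∞) * g y ∂μ := by
        refine lintegral_congr fun y ↦ ?_
        rw [ENNReal.tsum_mul_right, encard_preimage_inter_eq_tsum_indicator hAs hsA hdisj hAinj y]

/-- **Area formula with multiplicity** (Federer, *Geometric Measure Theory*, 3.2.3 and 3.2.5;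
Evans–Gariepy Thm. 3.8: "`∫_A Jf dx = ∫_{ℝⁿ} 𝓗⁰(A ∩ f⁻¹{y}) d𝓗ⁿ(y)`"), for a map `f`
differentiable on the measurable set `s` relative to `s` and locally injective on `s` (the
printed theorem is for Lipschitz `f` and needs no injectivity; this is its locally injective
case, with differentiability relative to `s` in place of the Lipschitz hypothesis): the integral
of the Jacobian `|det f'|` over `s` is the measure of `f '' s` counted with multiplicity,
`∫⁻_{s} |det f'| dμ = ∫⁻ #(f ⁻¹' {y} ∩ s) dμ(y)`. [cite: EvansGariepy2015, Thm. 3.8 (PDF p. 76)] -/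
theorem lintegral_abs_det_fderiv_eq_lintegral_encard (hs : MeasurableSet s)
    (hf' : ∀ x ∈ s, HasFDerivWithinAt f (f' x) s x)
    (hinj : ∀ x ∈ s, ∃ U ∈ 𝓝[s] x, InjOn f U) :
    ∫⁻ x in s, ENNReal.ofReal |(f' x).det| ∂μ = ∫⁻ y, ((f ⁻¹' {y} ∩ s).encard : ℝ≥0∞) ∂μ := by
  simpa using lintegral_abs_det_fderiv_mul_eq_lintegral_encard_mul μ hs hf' hinj
    (g := fun _ ↦ (1 : ℝ≥0∞)) measurable_const

/-- The multiplicity function `y ↦ #(f ⁻¹' {y} ∩ s)` of a map differentiable and locally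
injective on a measurable set `s` is measurable (it is a countable sum of indicators of the
measurable sets `f '' A n`, Mathlib `MeasureTheory.measurable_image_of_fderivWithin`, i.e. the
Lusin–Souslin theorem; cf. Evans–Gariepy Lemma 3.5 / Federer 3.2.3 for the measurability of the
multiplicity function). [folklore] -/
theorem measurable_encard_preimage_inter (hs : MeasurableSet s)
    (hf' : ∀ x ∈ s, HasFDerivWithinAt f (f' x) s x)
    (hinj : ∀ x ∈ s, ∃ U ∈ 𝓝[s] x, InjOn f U) :
    Measurable fun y ↦ ((f ⁻¹' {y} ∩ s).encard : ℝ≥0∞) := by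
  rcases s.eq_empty_or_nonempty with rfl | hne
  · simp
  obtain ⟨A, hAm, hAs, hsA, hdisj, hAinj⟩ := exists_disjoint_cover_injOn hs hne hinj
  have hderiv : ∀ n, ∀ x ∈ A n, HasFDerivWithinAt f (f' x) (A n) x :=
    fun n x hx ↦ (hf' x (hAs n hx)).mono (hAs n)
  have himg : ∀ n, MeasurableSet (f '' A n) :=
    fun n ↦ measurable_image_of_fderivWithin (hAm n) (hderiv n) (hAinj n)
  have heq : (fun y ↦ ((f ⁻¹' {y} ∩ s).encard : ℝ≥0∞)) =
      fun y ↦ ∑' n, (f '' A n).indicator 1 y :=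
    funext (encard_preimage_inter_eq_tsum_indicator hAs hsA hdisj hAinj)
  rw [heq]
  exact Measurable.tsum fun n ↦ measurable_one.indicator (himg n)

/-- The area formula with multiplicity on an **open** set, for a map differentiable at every
point of the set and locally injective there (neighbourhoods in `E` rather than within `s`).
[cite: EvansGariepy2015, Thm. 3.8 (PDF p. 76)] -/
theorem lintegral_abs_det_fderiv_mul_eq_lintegral_encard_mul_of_isOpen (hs : IsOpen s)
    (hf' : ∀ x ∈ s, HasFDerivAt f (f' x) x) (hinj : ∀ x ∈ s, ∃ U ∈ 𝓝 x, InjOn f U)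
    {g : E → ℝ≥0∞} (hg : Measurable g) :
    ∫⁻ x in s, ENNReal.ofReal |(f' x).det| * g (f x) ∂μ =
      ∫⁻ y, ((f ⁻¹' {y} ∩ s).encard : ℝ≥0∞) * g y ∂μ :=
  lintegral_abs_det_fderiv_mul_eq_lintegral_encard_mul μ hs.measurableSet
    (fun x hx ↦ (hf' x hx).hasFDerivWithinAt)
    (fun x hx ↦ let ⟨U, hU, h⟩ := hinj x hx; ⟨U, mem_nhdsWithin_of_mem_nhds hU, h⟩) hg

omit [FiniteDimensional ℝ E] [MeasurableSpace E] [BorelSpace E] in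
/-- **Inverse function theorem, injectivity half**: a map with an invertible strict derivative
at `x` is injective on a neighbourhood of `x` (Mathlib's
`HasStrictFDerivAt.eventually_left_inverse` repackaged). [folklore] -/
theorem exists_injOn_nhds_of_hasStrictFDerivAt {F : Type*} [NormedAddCommGroup F]
    [NormedSpace ℝ F] [CompleteSpace E] {φ : E → F} {φ' : E ≃L[ℝ] F} {x : E}
    (hφ : HasStrictFDerivAt φ (φ' : E →L[ℝ] F) x) : ∃ U ∈ 𝓝 x, InjOn φ U := by
  refine ⟨{z | HasStrictFDerivAt.localInverse φ φ' x hφ (φ z) = z},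
    HasStrictFDerivAt.eventually_left_inverse hφ, ?_⟩
  intro z hz z' hz' h
  rw [mem_setOf_eq] at hz hz'
  rw [← hz, ← hz', h]

/-- **Area formula with multiplicity for an immersion** (Evans–Gariepy Thm. 3.8, case
`Jf > 0`): on an open set on which `f` has a strict derivative with non-zero determinant at
every point, `∫⁻_{s} |det f'| dμ = ∫⁻ #(f ⁻¹' {y} ∩ s) dμ(y)`; local injectivity comes from the
inverse function theorem. [cite: EvansGariepy2015, Thm. 3.8 (PDF p. 76)] -/
theorem lintegral_abs_det_fderiv_eq_lintegral_encard_of_det_ne_zero (hs : IsOpen s)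
    (hf' : ∀ x ∈ s, HasStrictFDerivAt f (f' x) x) (hdet : ∀ x ∈ s, (f' x).det ≠ 0) :
    ∫⁻ x in s, ENNReal.ofReal |(f' x).det| ∂μ = ∫⁻ y, ((f ⁻¹' {y} ∩ s).encard : ℝ≥0∞) ∂μ := by
  have hinj : ∀ x ∈ s, ∃ U ∈ 𝓝 x, InjOn f U := by
    intro x hx
    have h : HasStrictFDerivAt f
        (((f' x).toContinuousLinearEquivOfDetNeZero (hdet x hx) : E ≃L[ℝ] E) : E →L[ℝ] E) x := by
      simpa using hf' x hx
    exact exists_injOn_nhds_of_hasStrictFDerivAt h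
  simpa using lintegral_abs_det_fderiv_mul_eq_lintegral_encard_mul_of_isOpen μ hs
    (fun x hx ↦ (hf' x hx).hasFDerivAt) hinj (g := fun _ ↦ (1 : ℝ≥0∞)) measurable_const

end Area

end Literature.Analysis.Calculus

end
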